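import Summits.BirchSwinnertonDyer.BirchSwinnertonDyer.Theorems.ManinLocalTwoThreeConductorExponentThreeAtTwo
import Literature.NumberTheory.DiophantineGeometry.TateAlgorithmIstarSuccNormalFormProofs
import Literature.NumberTheory.DiophantineGeometry.TateAlgorithmOggBound
import HarnessLib

/-!
# `Iₙ*` (`n ≥ 2`) at `2` with `4 ∣ a₁` on a step-6-normalised model has `ord Δ ≥ n + 9` — the `Iₙ*` loop with the invariant `a₁ ∈ 𝔪²`
# (route `ManinLocalTwoThree`, crux C2 `ManinOddAtFour` stmt-BirchSwinnertonDyer-22967;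
# an g32 §11 S-an-63 «16 ∥ N descends», rows `I₄*/12`, `Iₙ≥5*/(n+8)`; cell bsd-f2-manin, p2 gen 14)

§1 is this seat's (p2 g13) sharpened `Iₙ*` loop of `ManinLocalTwoThreeConductorExponentThreeAtTwo` with ONE MORE INVARIANT, `a₁ ∈ 𝔪²`:
it survives every admissible `u = 1` change between step-6-normalised models (`OggBound.t_mem_sq_of_smul`: `s ∈ 𝔪`, and
`a₁ ↦ a₁ + 2s`), and improves the round-`m` orders to `ord b₂ ≥ 3`, `ord b₄ ≥ m + 4`, so `ord Δ ≥ min(2m+11, 3m+15, 4m+8, 3m+11)`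
at exit `n = 2m+1` and `ord Δ ≥ 2m + 12` at exit `n = 2m+2`: `ord Δ ≥ n + 9` for every `n ≥ 2`.  §2 lifts this to a step-7-shaped
model `V` with `kodairaSymbolOfMinimal V = Iₙ*`.  Sequel (over a DVR in which `2` is a uniformiser): on the tree's Step-7 form
`[2α, 2β, 4γ, 8q, 16r]` of a curve of type `Iₙ*` with `ord Δ = n + 8`, `n ≥ 4` — the `f = 4` rows of p3's
`kodairaSymbolAt_of_conductorExponent_eq_four_two` — `α` is then a unit, `ord c₄ = 4` and `ord₂ j = 4 − n ≤ 0`: that is the sequel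
`ManinLocalTwoThreeIstarDeepAtTwoOrdJ`, which feeds `1 ≤ |j|₂` to `ManinLocalTwoThreeSixteenDescendsOrdJ` (Barrios et al. 2025, Table
localdata-dodd: these rows are the `v(a₁) = 1` rows, the twists by `d ≡ 3 (mod 4)` of `I_{n−4}` resp. `I₀`).  This file: §1 the loop, §2 the lift
to `kodairaSymbolOfMinimal`.
HONEST FRAMING: local bookkeeping (Silverman *ATAEC* IV.9.4 Step 7; Papadopoulos 1993 Table IV), kernel-checked; nothing about BSD or
Manin's conjecture is proved; C2 OPEN. [cite: SilvermanATAEC1994, IV.9.4 Step 7 (PDF pp. 345–346) and Table 4.1]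
[cite: Papadopoulos1993, Table IV (p = 2)] [cite: BarriosEtAl2025, Thm. 5.1, Table localdata-dodd, rows I*ₙ (arXiv:2501.03209 p. 16)]
-/

set_option autoImplicit false
-- lint-debt: the directory name repeats the summit name (sibling precedent `ManinLocalTwoThreeConductorExponentThreeAtTwo.lean`)
set_option linter.dupNamespace false

noncomputable section

open Polynomial IsLocalRing
open IsDiscreteValuationRing hiding maximalIdeal
open Literature.NumberTheory.DiophantineGeometry Literature.NumberTheory.DiophantineGeometry.TateAlgorithm
  Literature.NumberTheory.DiophantineGeometry.TateAlgorithm.CharTwo Literature.NumberTheory.EllipticCurves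

namespace Summit.BirchSwinnertonDyer.BirchSwinnertonDyer.Theorems.ManinLocalTwoThree

/-! ## §1 The `Iₙ*` loop with the invariant `a₁ ∈ 𝔪²` -/

section Loop

variable {R : Type*} [CommRing R] [IsDomain R] [IsDiscreteValuationRing R]

/-- **`a₁ ∈ 𝔪²` survives an admissible change between step-6-normalised models** (`u = 1`; then `s ∈ 𝔪` by rigidity and
`a₁ ↦ a₁ + 2s` with `2 ∈ 𝔪`). [cite: SilvermanATAEC1994, IV.9.4 Step 7] -/
theorem a₁_mem_sq_of_smul_of_two_mem (h2 : (2 : R) ∈ maximalIdeal R) {V : WeierstrassCurve R}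
    {D : WeierstrassCurve.VariableChange R} (hu : D.u = 1) (h1 : V.a₁ ∈ maximalIdeal R ^ 2) (h₂ : V.a₂ ∈ maximalIdeal R)
    (h3 : V.a₃ ∈ maximalIdeal R ^ 2) (h4 : V.a₄ ∈ maximalIdeal R ^ 2) (h6 : V.a₆ ∈ maximalIdeal R ^ 3)
    (h1' : (D • V).a₁ ∈ maximalIdeal R) (h2' : (D • V).a₂ ∈ maximalIdeal R) (h3' : (D • V).a₃ ∈ maximalIdeal R ^ 2)
    (h4' : (D • V).a₄ ∈ maximalIdeal R ^ 2) (h6' : (D • V).a₆ ∈ maximalIdeal R ^ 3) :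
    (D • V).a₁ ∈ maximalIdeal R ^ 2 := by
  have h1m : V.a₁ ∈ maximalIdeal R := Ideal.pow_le_self two_ne_zero h1
  obtain ⟨-, hs, -⟩ := OggBound.t_mem_sq_of_smul hu h1m h₂ h3 h4 h6 h1' h2' h3' h4' h6'
  rw [smul_a₁_of_u_eq_one hu]
  refine add_mem h1 ?_
  rw [pow_two]
  exact Ideal.mul_mem_mul h2 hs

/-- **Round `m ≥ 1` with `a₁ ∈ 𝔪²`, `2 ∈ 𝔪`: `π^{2m+10} ∣ Δ`** (`ord b₂ ≥ 3`, `ord b₄ ≥ m + 4`, `ord b₆ ≥ 2m + 4`, `ord b₈ ≥ 2m + 5`;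
`min(2m+11, 3m+15, 4m+8, 3m+11) ≥ 2m + 10` once `m ≥ 1`). [cite: SilvermanATAEC1994, IV.9.4 Step 7] -/
theorem Δ_mem_pow_of_istarRoundA_of_a₁_mem_sq (h2 : (2 : R) ∈ maximalIdeal R) (V : WeierstrassCurve R) {m : ℕ}
    (hm : 1 ≤ m) (h1 : V.a₁ ∈ maximalIdeal R ^ 2) (h₂ : V.a₂ ∈ maximalIdeal R) (h3 : V.a₃ ∈ maximalIdeal R ^ (m + 2))
    (h4 : V.a₄ ∈ maximalIdeal R ^ (m + 3)) (h6 : V.a₆ ∈ maximalIdeal R ^ (2 * m + 4)) :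
    V.Δ ∈ maximalIdeal R ^ (2 * m + 10) := by
  have h21 : V.a₂ ∈ maximalIdeal R ^ 1 := by rwa [pow_one]
  exact Δ_mem_pow_of_a_of_two_mem V h2 3 (m + 4) (2 * m + 4) (2 * m + 5) h1 h21 h3 h4 h6

/-- **After the `y`-translation of round `m` with `a₁ ∈ 𝔪²`, `2 ∈ 𝔪`: `π^{2m+11} ∣ Δ`** (`ord b₄ ≥ m + 4`, `ord b₆ ≥ 2m + 6`,
`ord b₈ ≥ 2m + 6`; `min(2m+12, 3m+15, 4m+12, 3m+13) ≥ 2m + 11`). [cite: SilvermanATAEC1994, IV.9.4 Step 7] -/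
theorem Δ_mem_pow_of_istarRoundB_of_a₁_mem_sq (h2 : (2 : R) ∈ maximalIdeal R) (V : WeierstrassCurve R) (m : ℕ)
    (h1 : V.a₁ ∈ maximalIdeal R ^ 2) (h₂ : V.a₂ ∈ maximalIdeal R) (h3 : V.a₃ ∈ maximalIdeal R ^ (m + 3))
    (h4 : V.a₄ ∈ maximalIdeal R ^ (m + 3)) (h6 : V.a₆ ∈ maximalIdeal R ^ (2 * m + 5)) :
    V.Δ ∈ maximalIdeal R ^ (2 * m + 11) := by
  have h21 : V.a₂ ∈ maximalIdeal R ^ 1 := by rwa [pow_one]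
  exact Δ_mem_pow_of_a_of_two_mem V h2 3 (m + 4) (2 * m + 6) (2 * m + 6) h1 h21 h3 h4 h6

/-- **The `Iₙ*` loop from a round `m ≥ 1` with `a₁ ∈ 𝔪²` keeps `π^{n+9} ∣ Δ`** (`n = istarIndexAux fuel m V`; perfect residue field,
`2 ∈ 𝔪`). [cite: SilvermanATAEC1994, IV.9.4 Step 7] -/
theorem Δ_mem_pow_istarIndexAux_of_a₁_mem_sq_of_one_le [PerfectField (ResidueField R)] (h2 : (2 : R) ∈ maximalIdeal R) :
    ∀ (fuel m : ℕ) (V : WeierstrassCurve R), 1 ≤ m → V.a₁ ∈ maximalIdeal R ^ 2 → V.a₂ ∈ maximalIdeal R →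
      V.a₂ ∉ maximalIdeal R ^ 2 → V.a₃ ∈ maximalIdeal R ^ (m + 2) →
      V.a₄ ∈ maximalIdeal R ^ (m + 3) → V.a₆ ∈ maximalIdeal R ^ (2 * m + 4) →
      V.Δ ∈ maximalIdeal R ^ (istarIndexAux fuel m V + 9) := by
  classical
  intro fuel
  induction fuel with
  | zero =>
    intro m V hm h1 h₂ _ h3 h4 h6
    rw [istarIndexAux_zero]
    exact Ideal.pow_le_pow_right (by omega) (Δ_mem_pow_of_istarRoundA_of_a₁_mem_sq h2 V hm h1 h₂ h3 h4 h6)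
  | succ k ih =>
    intro m V hm h1 h₂ h2n h3 h4 h6
    have h1m : V.a₁ ∈ maximalIdeal R := Ideal.pow_le_self two_ne_zero h1
    rw [istarIndexAux_succ]
    dsimp only
    by_cases hq1 : distinctRootCount
        (X ^ 2 + C (redCoeff V.a₃ (m + 2)) * X - C (redCoeff V.a₆ (2 * m + 4))) = 2
    · rw [if_pos hq1, show 2 * m + 1 + 9 = 2 * m + 10 by omega]
      exact Δ_mem_pow_of_istarRoundA_of_a₁_mem_sq h2 V hm h1 h₂ h3 h4 h6
    rw [if_neg hq1]
    have hexA : ∃ C : WeierstrassCurve.VariableChange R, C.u = 1 ∧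
        (C • V).a₁ ∈ maximalIdeal R ∧ (C • V).a₂ ∈ maximalIdeal R ∧
        (C • V).a₃ ∈ maximalIdeal R ^ (m + 3) ∧ (C • V).a₄ ∈ maximalIdeal R ^ (m + 3) ∧
        (C • V).a₆ ∈ maximalIdeal R ^ (2 * m + 5) :=
      exists_variableChange_istarA_of_perfectField h1m h₂ h3 h4 h6 hq1
    rw [dif_pos hexA]
    obtain ⟨hu1, hA₁, hA₂, hA₃, hA₄, hA₆⟩ := hexA.choose_spec
    set V1 := hexA.choose • V with hV1
    have hΔ1 : V1.Δ = V.Δ := Δ_smul_of_u_eq_one hu1 _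
    have hA₂n : V1.a₂ ∉ maximalIdeal R ^ 2 :=
      OggBound.a₂_not_mem_sq_of_smul hu1 h1m h₂ h2n (Ideal.pow_le_pow_right (by omega) h3)
        (Ideal.pow_le_pow_right (by omega) h4) (Ideal.pow_le_pow_right (by omega) h6) hA₁ hA₂
        (Ideal.pow_le_pow_right (by omega) hA₃) (Ideal.pow_le_pow_right (by omega) hA₄)
        (Ideal.pow_le_pow_right (by omega) hA₆)
    have hA₁2 : V1.a₂ ∈ maximalIdeal R := hA₂
    have hA₁sq : V1.a₁ ∈ maximalIdeal R ^ 2 :=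
      a₁_mem_sq_of_smul_of_two_mem h2 hu1 h1 h₂ (Ideal.pow_le_pow_right (by omega) h3) (Ideal.pow_le_pow_right (by omega) h4)
        (Ideal.pow_le_pow_right (by omega) h6) hA₁ hA₂ (Ideal.pow_le_pow_right (by omega) hA₃)
        (Ideal.pow_le_pow_right (by omega) hA₄) (Ideal.pow_le_pow_right (by omega) hA₆)
    by_cases hq2 : distinctRootCount (C (redCoeff V1.a₂ 1) * X ^ 2 +
        C (redCoeff V1.a₄ (m + 3)) * X + C (redCoeff V1.a₆ (2 * m + 5))) = 2
    · rw [if_pos hq2, ← hΔ1, show 2 * m + 2 + 9 = 2 * m + 11 by omega]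
      exact Δ_mem_pow_of_istarRoundB_of_a₁_mem_sq h2 V1 m hA₁sq hA₁2 hA₃ hA₄ hA₆
    rw [if_neg hq2]
    have hexB : ∃ C : WeierstrassCurve.VariableChange R, C.u = 1 ∧
        (C • V1).a₁ ∈ maximalIdeal R ∧ (C • V1).a₂ ∈ maximalIdeal R ∧
        (C • V1).a₃ ∈ maximalIdeal R ^ (m + 3) ∧ (C • V1).a₄ ∈ maximalIdeal R ^ (m + 4) ∧
        (C • V1).a₆ ∈ maximalIdeal R ^ (2 * m + 6) :=
      exists_variableChange_istarB_of_perfectField hA₁ hA₂ hA₂n hA₃ hA₄ hA₆ hq2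
    rw [dif_pos hexB]
    obtain ⟨hu2, hB₁, hB₂, hB₃, hB₄, hB₆⟩ := hexB.choose_spec
    set V2 := hexB.choose • V1 with hV2
    have hΔ2 : V2.Δ = V.Δ := (Δ_smul_of_u_eq_one hu2 _).trans hΔ1
    have hB₂n : V2.a₂ ∉ maximalIdeal R ^ 2 :=
      OggBound.a₂_not_mem_sq_of_smul hu2 hA₁ hA₂ hA₂n (Ideal.pow_le_pow_right (by omega) hA₃)
        (Ideal.pow_le_pow_right (by omega) hA₄) (Ideal.pow_le_pow_right (by omega) hA₆) hB₁ hB₂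
        (Ideal.pow_le_pow_right (by omega) hB₃) (Ideal.pow_le_pow_right (by omega) hB₄)
        (Ideal.pow_le_pow_right (by omega) hB₆)
    have hB₁sq : V2.a₁ ∈ maximalIdeal R ^ 2 :=
      a₁_mem_sq_of_smul_of_two_mem h2 hu2 hA₁sq hA₂ (Ideal.pow_le_pow_right (by omega) hA₃)
        (Ideal.pow_le_pow_right (by omega) hA₄) (Ideal.pow_le_pow_right (by omega) hA₆) hB₁ hB₂
        (Ideal.pow_le_pow_right (by omega) hB₃) (Ideal.pow_le_pow_right (by omega) hB₄) (Ideal.pow_le_pow_right (by omega) hB₆)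
    have key := ih (m + 1) V2 (by omega) hB₁sq hB₂ hB₂n hB₃ hB₄
      (by rw [show 2 * (m + 1) + 4 = 2 * m + 6 by ring]; exact hB₆)
    rw [hΔ2] at key
    exact key

/-- **The `Iₙ*` loop from round `0` with `a₁ ∈ 𝔪²` keeps `π^{n+9} ∣ Δ` whenever `n ≥ 2`** (round `0` exits `n = 1` — excluded —,
or `n = 2` with `ord Δ ≥ 11`, or hands over to round `1`). [cite: SilvermanATAEC1994, IV.9.4 Step 7] -/
theorem Δ_mem_pow_istarIndexAux_zero_of_a₁_mem_sq [PerfectField (ResidueField R)] (h2 : (2 : R) ∈ maximalIdeal R)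
    (fuel : ℕ) (V : WeierstrassCurve R) (h1 : V.a₁ ∈ maximalIdeal R ^ 2) (h₂ : V.a₂ ∈ maximalIdeal R)
    (h2n : V.a₂ ∉ maximalIdeal R ^ 2) (h3 : V.a₃ ∈ maximalIdeal R ^ 2) (h4 : V.a₄ ∈ maximalIdeal R ^ 3)
    (h6 : V.a₆ ∈ maximalIdeal R ^ 4) (hn : 2 ≤ istarIndexAux fuel 0 V) :
    V.Δ ∈ maximalIdeal R ^ (istarIndexAux fuel 0 V + 9) := by
  classical
  have h1m : V.a₁ ∈ maximalIdeal R := Ideal.pow_le_self two_ne_zero h1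
  cases fuel with
  | zero => rw [istarIndexAux_zero] at hn; omega
  | succ k =>
    rw [istarIndexAux_succ] at hn ⊢
    dsimp only at hn ⊢
    by_cases hq1 : distinctRootCount
        (X ^ 2 + C (redCoeff V.a₃ (0 + 2)) * X - C (redCoeff V.a₆ (2 * 0 + 4))) = 2
    · rw [if_pos hq1] at hn; omega
    rw [if_neg hq1] at hn ⊢
    have hexA : ∃ C : WeierstrassCurve.VariableChange R, C.u = 1 ∧
        (C • V).a₁ ∈ maximalIdeal R ∧ (C • V).a₂ ∈ maximalIdeal R ∧
        (C • V).a₃ ∈ maximalIdeal R ^ (0 + 3) ∧ (C • V).a₄ ∈ maximalIdeal R ^ (0 + 3) ∧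
        (C • V).a₆ ∈ maximalIdeal R ^ (2 * 0 + 5) :=
      exists_variableChange_istarA_of_perfectField h1m h₂ (by simpa using h3) (by simpa using h4)
        (by simpa using h6) hq1
    rw [dif_pos hexA] at hn ⊢
    obtain ⟨hu1, hA₁, hA₂, hA₃, hA₄, hA₆⟩ := hexA.choose_spec
    set V1 := hexA.choose • V with hV1
    have hΔ1 : V1.Δ = V.Δ := Δ_smul_of_u_eq_one hu1 _
    have hA₂n : V1.a₂ ∉ maximalIdeal R ^ 2 :=
      OggBound.a₂_not_mem_sq_of_smul hu1 h1m h₂ h2n (Ideal.pow_le_pow_right (by omega) h3)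
        (Ideal.pow_le_pow_right (by omega) h4) (Ideal.pow_le_pow_right (by omega) h6) hA₁ hA₂
        (Ideal.pow_le_pow_right (by omega) hA₃) (Ideal.pow_le_pow_right (by omega) hA₄)
        (Ideal.pow_le_pow_right (by omega) hA₆)
    have hA₁sq : V1.a₁ ∈ maximalIdeal R ^ 2 :=
      a₁_mem_sq_of_smul_of_two_mem h2 hu1 h1 h₂ h3 (Ideal.pow_le_pow_right (by omega) h4)
        (Ideal.pow_le_pow_right (by omega) h6) hA₁ hA₂ (Ideal.pow_le_pow_right (by omega) hA₃)
        (Ideal.pow_le_pow_right (by omega) hA₄) (Ideal.pow_le_pow_right (by omega) hA₆)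
    by_cases hq2 : distinctRootCount (C (redCoeff V1.a₂ 1) * X ^ 2 +
        C (redCoeff V1.a₄ (0 + 3)) * X + C (redCoeff V1.a₆ (2 * 0 + 5))) = 2
    · rw [if_pos hq2, ← hΔ1]
      have h := Δ_mem_pow_of_istarRoundB_of_a₁_mem_sq h2 V1 0 hA₁sq hA₂ hA₃ hA₄ hA₆
      simpa using h
    rw [if_neg hq2] at hn ⊢
    have hexB : ∃ C : WeierstrassCurve.VariableChange R, C.u = 1 ∧
        (C • V1).a₁ ∈ maximalIdeal R ∧ (C • V1).a₂ ∈ maximalIdeal R ∧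
        (C • V1).a₃ ∈ maximalIdeal R ^ (0 + 3) ∧ (C • V1).a₄ ∈ maximalIdeal R ^ (0 + 4) ∧
        (C • V1).a₆ ∈ maximalIdeal R ^ (2 * 0 + 6) :=
      exists_variableChange_istarB_of_perfectField hA₁ hA₂ hA₂n hA₃ hA₄ hA₆ hq2
    rw [dif_pos hexB] at hn ⊢
    obtain ⟨hu2, hB₁, hB₂, hB₃, hB₄, hB₆⟩ := hexB.choose_spec
    set V2 := hexB.choose • V1 with hV2
    have hΔ2 : V2.Δ = V.Δ := (Δ_smul_of_u_eq_one hu2 _).trans hΔ1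
    have hB₂n : V2.a₂ ∉ maximalIdeal R ^ 2 :=
      OggBound.a₂_not_mem_sq_of_smul hu2 hA₁ hA₂ hA₂n (Ideal.pow_le_pow_right (by omega) hA₃)
        (Ideal.pow_le_pow_right (by omega) hA₄) (Ideal.pow_le_pow_right (by omega) hA₆) hB₁ hB₂
        (Ideal.pow_le_pow_right (by omega) hB₃) (Ideal.pow_le_pow_right (by omega) hB₄)
        (Ideal.pow_le_pow_right (by omega) hB₆)
    have hB₁sq : V2.a₁ ∈ maximalIdeal R ^ 2 :=
      a₁_mem_sq_of_smul_of_two_mem h2 hu2 hA₁sq hA₂ (Ideal.pow_le_pow_right (by omega) hA₃)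
        (Ideal.pow_le_pow_right (by omega) hA₄) (Ideal.pow_le_pow_right (by omega) hA₆) hB₁ hB₂
        (Ideal.pow_le_pow_right (by omega) hB₃) (Ideal.pow_le_pow_right (by omega) hB₄) (Ideal.pow_le_pow_right (by omega) hB₆)
    have key := Δ_mem_pow_istarIndexAux_of_a₁_mem_sq_of_one_le h2 k 1 V2 le_rfl hB₁sq hB₂ hB₂n (by simpa using hB₃)
      (by simpa using hB₄) (by simpa using hB₆)
    rw [hΔ2] at key
    exact key

/-- **Step 7 with `a₁ ∈ 𝔪²` on a step-6-normalised model whose cubic has exactly two roots: `π^{n+9} ∣ Δ` for `n = istarIndex V ≥ 2`.**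
[cite: SilvermanATAEC1994, IV.9.4 Step 7] -/
theorem Δ_mem_pow_istarIndex_of_a₁_mem_sq [PerfectField (ResidueField R)]
    (h2 : (2 : R) ∈ maximalIdeal R) {V : WeierstrassCurve R}
    (h1 : V.a₁ ∈ maximalIdeal R ^ 2) (h₂ : V.a₂ ∈ maximalIdeal R) (h3 : V.a₃ ∈ maximalIdeal R ^ 2)
    (h4 : V.a₄ ∈ maximalIdeal R ^ 2) (h6 : V.a₆ ∈ maximalIdeal R ^ 3)
    (hP : distinctRootCount (cubicStep6 V) = 2) (hn : 2 ≤ istarIndex V) :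
    V.Δ ∈ maximalIdeal R ^ (istarIndex V + 9) := by
  classical
  have h1m : V.a₁ ∈ maximalIdeal R := Ideal.pow_le_self two_ne_zero h1
  have hex : ∃ C : WeierstrassCurve.VariableChange R, C.u = 1 ∧
      (C • V).a₁ ∈ maximalIdeal R ∧ (C • V).a₂ ∈ maximalIdeal R ∧ (C • V).a₃ ∈ maximalIdeal R ^ 2 ∧
      (C • V).a₄ ∈ maximalIdeal R ^ 3 ∧ (C • V).a₆ ∈ maximalIdeal R ^ 4 :=
    exists_variableChange_step7_of_perfectField h1m h₂ h3 h4 h6 hP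
  unfold istarIndex at hn ⊢
  dsimp only at hn ⊢
  rw [dif_pos hex] at hn ⊢
  obtain ⟨hu7, hA₁, hA₂, hA₃, hA₄, hA₆⟩ := hex.choose_spec
  set V7 := hex.choose • V with hV7
  have hΔ7 : V7.Δ = V.Δ := Δ_smul_of_u_eq_one hu7 _
  have hA₁sq : V7.a₁ ∈ maximalIdeal R ^ 2 :=
    a₁_mem_sq_of_smul_of_two_mem h2 hu7 h1 h₂ h3 h4 h6 hA₁ hA₂ hA₃ (Ideal.pow_le_pow_right (by norm_num) hA₄)
      (Ideal.pow_le_pow_right (by norm_num) hA₆)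
  have hA₂n : V7.a₂ ∉ maximalIdeal R ^ 2 := by
    obtain ⟨hr, hs, ht⟩ := OggBound.t_mem_sq_of_smul hu7 h1m h₂ h3 h4 h6 hA₁ hA₂ hA₃
      (Ideal.pow_le_pow_right (by norm_num) hA₄) (Ideal.pow_le_pow_right (by norm_num) hA₆)
    obtain ⟨c, hc⟩ := OggBound.cubicStep6_smul hu7 h1m h₂ h3 h4 h6 hr hs ht
    intro hA₂2
    obtain ⟨p, hp⟩ := mem_maximalIdeal_iff_dvd.mp hA₂
    obtain ⟨q, hq⟩ := mem_maximalIdeal_pow_iff_dvd.mp hA₄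
    obtain ⟨w, hw⟩ := mem_maximalIdeal_pow_iff_dvd.mp hA₆
    have hϖ : residue R (uniformizer R) = 0 :=
      OggBound.residue_eq_zero_of_mem uniformizer_mem_maximalIdeal
    have hp0 : residue R p = 0 := by
      have h' : uniformizer R ^ 1 * 1 * p ∈ maximalIdeal R ^ (1 + 1) := by
        rw [pow_one, mul_one, ← hp]; exact hA₂2
      have := OggBound.mem_pow_of_uniformizer_pow_mul_mem isUnit_one h'
      rw [pow_one] at this
      exact OggBound.residue_eq_zero_of_mem this
    have hq0 : residue R (uniformizer R * q) = 0 := by rw [map_mul, hϖ, zero_mul]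
    have hw0 : residue R (uniformizer R * w) = 0 := by rw [map_mul, hϖ, zero_mul]
    have hcubic7 : cubicStep6 V7 = X ^ 3 + C 0 * X ^ 2 + C 0 * X + C 0 := by
      rw [cubicStep6_eq (q := uniformizer R * q) (r := uniformizer R * w) hp (by rw [hq]; ring)
        (by rw [hw]; ring), hp0, hq0, hw0]
    have := OggBound.distinctRootCount_comp_X_add_C (cubicStep6 V) c
    rw [← hc, hcubic7, OggBound.distinctRootCount_cube, hP] at this
    exact absurd this (by norm_num)
  have key := Δ_mem_pow_istarIndexAux_zero_of_a₁_mem_sq h2 (addVal R V.Δ).toNat V7 hA₁sq hA₂ hA₂n hA₃ hA₄ hA₆ hn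
  rw [hΔ7] at key
  convert key using 2

end Loop

/-! ## §2 `kodairaSymbolOfMinimal V = Iₙ*` (`n ≥ 2`) on a step-6-normalised `V` with `a₁ ∈ 𝔪²`: `ord Δ ≥ n + 9` -/

section Symbol

variable {R : Type*} [CommRing R] [IsDomain R] [IsDiscreteValuationRing R]

/-- **Output `Iₙ*` with `n ≥ 2` in residue characteristic `2` on a step-6-normalised model with `4 ∣ a₁`: `ord Δ ≥ n + 9`** (perfect residue
field, `2 ∈ 𝔪`, `Δ ≠ 0`; stated for `Istar (n + 2)` as `n + 11 ≤ ord Δ`).  The algorithm's own normalisations from `V` to the start of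
the loop are `u = 1` changes between step-6-normalised models, so `a₁ ∈ 𝔪²` reaches the loop (`a₁_mem_sq_of_smul_of_two_mem`).
[cite: SilvermanATAEC1994, IV.9.4 Step 7] -/
theorem le_addVal_Δ_toNat_of_kodairaSymbolOfMinimal_eq_Istar_succ_succ_of_a₁_mem_sq
    [PerfectField (ResidueField R)] (h2 : (2 : R) ∈ maximalIdeal R) (V : WeierstrassCurve R)
    (hΔ0 : V.Δ ≠ 0) (h1 : V.a₁ ∈ maximalIdeal R ^ 2) (h₂ : V.a₂ ∈ maximalIdeal R) (h3 : V.a₃ ∈ maximalIdeal R ^ 2)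
    (h4 : V.a₄ ∈ maximalIdeal R ^ 2) (h6 : V.a₆ ∈ maximalIdeal R ^ 3) {n : ℕ}
    (hV : V.kodairaSymbolOfMinimal = .Istar (n + 2)) :
    n + 11 ≤ (addVal R V.Δ).toNat := by
  classical
  have hϖ : Irreducible (uniformizer R) := irreducible_uniformizer
  have h1m : V.a₁ ∈ maximalIdeal R := Ideal.pow_le_self two_ne_zero h1
  unfold WeierstrassCurve.kodairaSymbolOfMinimal at hV
  obtain ⟨hΔm, h2', h3', h4', h5', h6', h7', hidx⟩ :=
    (tateTree_eq_Istar_succ_iff _ _ _ _ _ _ _ _ _ _ _ _ _).mp hV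
  rw [not_not] at hΔm h2' h3' h4' h5'
  have hex2 := exists_variableChange_step2_of_perfectField V hΔm
  have hN2 : normalizeStep2 V = hex2.choose • V := dif_pos hex2
  obtain ⟨hu2, hA₃, hA₄, -⟩ := hex2.choose_spec
  rw [hN2] at h2' h3' h4' h5' h6' h7' hidx
  have hex6 := exists_variableChange_step6_of_perfectField h2' hA₃ hA₄ h3' h5' h4'
  have hN6 : normalizeStep6 (hex2.choose • V) = hex6.choose • (hex2.choose • V) :=
    dif_pos hex6
  obtain ⟨hu6, hB₁, hB₂, hB₃, hB₄, hB₆⟩ := hex6.choose_spec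
  rw [hN6] at h6' h7' hidx
  set W₆ := hex6.choose • (hex2.choose • V) with hW₆
  -- `W₆ = D • V` with `D.u = 1`: transport `a₁ ∈ 𝔪²`
  have hD : W₆ = (hex6.choose * hex2.choose) • V := by rw [hW₆, mul_smul]
  have hDu : (hex6.choose * hex2.choose).u = 1 := by
    simp only [WeierstrassCurve.VariableChange.mul_def, hu6, hu2, mul_one]
  have hB₁sq : W₆.a₁ ∈ maximalIdeal R ^ 2 := by
    rw [hD] at hB₁ hB₂ hB₃ hB₄ hB₆ ⊢
    exact a₁_mem_sq_of_smul_of_two_mem h2 hDu h1 h₂ h3 h4 h6 hB₁ hB₂ hB₃ hB₄ hB₆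
  have hΔ6 : W₆.Δ = V.Δ := by rw [hD, Δ_smul_of_u_eq_one hDu]
  have hmem := Δ_mem_pow_istarIndex_of_a₁_mem_sq h2 hB₁sq hB₂ hB₃ hB₄ hB₆ h7' (by rw [hidx]; omega)
  rw [hidx, hΔ6] at hmem
  have := le_addVal_toNat_of_pow_dvd hϖ hΔ0 (mem_maximalIdeal_pow_iff_dvd.mp hmem)
  omega

end Symbol

end Summit.BirchSwinnertonDyer.BirchSwinnertonDyer.Theorems.ManinLocalTwoThree

end
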